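import Summits.RiemannHypothesis.RiemannHypothesis.Theorems.JensenLogBandShellNearNumerics
import Summits.RiemannHypothesis.RiemannHypothesis.Theorems.JensenLogBandArcModelCompareNumeric
import Summits.RiemannHypothesis.RiemannHypothesis.Theorems.JensenLogBandEllPerturbation
import Summits.RiemannHypothesis.RiemannHypothesis.Theorems.JensenLogBandArcTransformEstimate
import Summits.RiemannHypothesis.RiemannHypothesis.Theorems.JensenLogBandArcSaddle
import Summits.RiemannHypothesis.RiemannHypothesis.Theorems.JensenLogBandArcDensityDeriv
import Summits.RiemannHypothesis.RiemannHypothesis.Theorems.JensenLogBandShellFarPieces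
import HarnessLib

/-!
# The near zone of the top shell, I: the two-sided window estimate at one disc point

RH ladder column JENSEN, rung J-P(P3) «log band», BAND crux `XiDerivBandRealAllRates`
(stmt-RiemannHypothesis-19913) of route «JensenLogBand», line «band-one-window» (u-arc, top-shell
reshape), lead rh-jensen-prover g8. RH-FREE. WHAT THIS IS NOT: nothing here bears on zeros of `ζ`
off the line or the truth of RH.

`near_disc_point`: in the top shell (`7 ≤ c < 8`, `a₀ = 2/c − ¼`, `h = h(k,T) ∈ (4/c, 0.595]`,
`ℓ = ℓ_T ≥ max(200, 32/a₀)`, `10⁴k² ≤ (a₀/2)T`) with centre `v₀ = x + iT`, `|x| ≤ a₀`, own saddle `u₀`,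
at every point `z = x' + iT'` with `‖z − v₀‖ ≤ 2/ℓ`:
`‖U_{k,h}(z) − M̃_{v₀,u₀}(z)‖ ≤ ‖M̃_{v₀,u₀}(z)‖/3`, where `M̃ = arcShiftModel k v₀ u₀` is the
translated-saddle model. Assembly of: the disc-point regime (`near_point_regime`, theory g12), the
window lemma at `z` with the centre's radius `h` (`norm_xiSqArcU_sub_arcMainTerm_le'`, S5, with
`ψ₁ = a₀/320`, `δ = a₀/2`), the model comparison `‖Main(z,u') − M̃(z)‖ ≤ ‖M̃(z)‖/100`
(`norm_arcMainTerm_sub_arcShiftModel_le_of_large`, [CMP], eng-2 g7), the lower bounds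
`‖ζ‖ ≥ a₀/4`, `(π/‖w‖)^{1/2} ≥ 2/√k`, and the numerics of `…ShellNearNumerics`.
-/

noncomputable section

-- single-problem summit: `Summit.RiemannHypothesis.RiemannHypothesis.…` is the tree convention
set_option linter.dupNamespace false

open Complex Real Set MeasureTheory intervalIntegral

namespace Summit.RiemannHypothesis.RiemannHypothesis.Theorems.JensenPolynomials.LogBandArc

open Literature.NumberTheory.LFunctions

/-- `disc_bound_core` with the window lemma's bracket shape `Z·W + P + Q`. [folklore] -/
theorem disc_bound_core' {U Mn M : ℂ} {N I Z s W P Q z₀ q : ℝ} (hN : 0 < N) (hI : 0 < I)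
    (hq : 0 < q) (hz₀ : 0 < z₀) (hS5 : ‖U - Mn‖ ≤ N * (I * (Z * W + P + Q)))
    (hMn : ‖Mn‖ = N * (I * Z * s)) (hs : 2 / q ≤ s) (hZ : z₀ ≤ Z)
    (hW : W ≤ 1 / 10 / q) (hJ : P + Q ≤ z₀ / 100 / q)
    (hcmp : ‖Mn - M‖ ≤ 1 / 100 * ‖M‖) : ‖U - M‖ ≤ 1 / 3 * ‖M‖ := by
  rw [add_assoc] at hS5
  exact disc_bound_core hN hI hq hz₀ hS5 hMn hs hZ hW hJ hcmp

/-- `ℓ_T ≤ T − 1` for `T ≥ 100`. [folklore] -/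
theorem ell_le_sub_one {T : ℝ} (hT : 100 ≤ T) : ell T ≤ T - 1 := by
  have hT0 : 0 < T := by linarith
  have h1 : ell T ≤ T / (2 * π) - 1 := Real.log_le_sub_one_of_pos (by positivity)
  have h2 : T / (2 * π) ≤ T := by
    rw [div_le_iff₀ (by positivity)]
    have := Real.pi_gt_three
    nlinarith
  linarith

set_option maxHeartbeats 1600000 in -- one long assembly of a dozen tree estimates; each step is small
/-- **The two-sided window estimate at a disc point** (RH-FREE). See the module docstring.
[folklore assembly of the tree's S5 / [CMP] / regime lemmas] -/
theorem near_disc_point {c a₀ : ℝ} {k : ℕ} {x T x' T' : ℝ} {u₀ : ℂ}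
    (hc7 : 7 ≤ c) (hc8 : c < 8) (ha₀ : 0 < a₀) (ha₀1 : a₀ ≤ 1 / 28)
    (hk100 : 100 ≤ k) (hE1 : 13000 * Real.sqrt k ≤ k)
    (hE2 : 4800 / (11 * (a₀ / 320)) * (k : ℝ) ^ 2 * Real.exp (-(11 * (a₀ / 320) ^ 2 / 40 * k)) ≤ 1)
    (hEC : π * Real.exp 14 * (1 + 1 / (a₀ / 2)) * (k : ℝ) ^ 2 *
      Real.exp (-((a₀ / 320) ^ 2 / 4 * k)) ≤ a₀ / 4 / 100 / 2)
    (hED : 161280 * Real.exp 14 * (k : ℝ) ^ 2 * Real.exp (-(7 * (a₀ / 4) / 4 * k)) ≤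
      a₀ / 4 / 100 / 2)
    (hlarge : (10 : ℝ) ^ 4 * (k : ℝ) ^ 2 ≤ a₀ / 2 * T)
    (hx : |x| ≤ a₀) (hT : 200 ≤ T) (hℓ : 200 ≤ ell T) (hℓa : 32 / a₀ ≤ ell T)
    (hℓlo : c * ((k : ℝ) - 1) / 2 - 4 ≤ ell T) (hℓhi : ell T ≤ c * (k : ℝ) / 2)
    (hh : 1 / 2 + 2 * a₀ < bandRadius k T) (hhub : bandRadius k T ≤ 119 / 200)
    (hhT : bandRadius k T ≤ 7 / 20 * T) (h1T : 1 / T ≤ 2 * a₀)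
    (hu₀ : ‖u₀ - ((x : ℂ) + (T : ℂ) * I + bandRadius k T)‖ ≤ 3 / 5 * bandRadius k T)
    (hS₀ : arcSaddleFn k ((x : ℂ) + (T : ℂ) * I) u₀ = 0)
    (hσ₀ : 1 + 7 * a₀ / 8 ≤ (1 / 2 + u₀).re)
    (hz : ‖((x' : ℂ) + (T' : ℂ) * I) - ((x : ℂ) + (T : ℂ) * I)‖ ≤ 2 / ell T) :
    ‖xiSqArcU k (bandRadius k T) ((x' : ℂ) + (T' : ℂ) * I) -
        arcShiftModel k ((x : ℂ) + (T : ℂ) * I) u₀ ((x' : ℂ) + (T' : ℂ) * I)‖ ≤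
      1 / 3 * ‖arcShiftModel k ((x : ℂ) + (T : ℂ) * I) u₀ ((x' : ℂ) + (T' : ℂ) * I)‖ := by
  have hkR : (100 : ℝ) ≤ k := by exact_mod_cast hk100
  have hk1 : (1 : ℝ) ≤ k := by linarith only [hkR]
  have hℓ0 : 0 < ell T := by linarith only [hℓ]
  have hT0 : 0 < T := by linarith only [hT]
  have hh0 : 0 < bandRadius k T := by linarith only [hh, ha₀]
  -- (0) the disc-point regime
  have hx9 : |x| ≤ 9 / 20 := hx.trans (by linarith only [ha₀1])
  have hx12 : |x| ≤ 1 / 2 := hx.trans (by linarith only [ha₀1])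
  have hT100 : 100 ≤ T := by linarith only [hT]
  have hℓ20 : 20 ≤ ell T := by linarith only [hℓ]
  have hh12 : 1 / 2 ≤ bandRadius k T := by linarith only [hh, ha₀]
  have hH20 : bandRadius k T ≤ 20 := by linarith only [hhub]
  have hH1 : bandRadius k T ≤ 1 := by linarith only [hhub]
  have hz3 : ‖((x' : ℂ) + (T' : ℂ) * I) - ((x : ℂ) + (T : ℂ) * I)‖ ≤ 3 / ell T :=
    hz.trans (div_le_div_of_nonneg_right (by norm_num) hℓ0.le)
  have hreg := near_point_regime k hx9 hT hℓ h1T hh.le hH1 hz3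
  have e_re : (((x' : ℂ) + (T' : ℂ) * I)).re = x' := by simp
  have e_im : (((x' : ℂ) + (T' : ℂ) * I)).im = T' := by simp
  rw [e_re, e_im] at hreg
  obtain ⟨hx', hT'100, hℓ'd, hℓ'100, hhd, hh', hH', hh'T'⟩ := hreg
  have hℓ'20 : 20 ≤ ell T' := by linarith only [hℓ'100]
  have hℓ'0 : 0 < ell T' := by linarith only [hℓ'100]
  have hT'0 : 0 < T' := by linarith only [hT'100]
  obtain ⟨hℓ'lo, hℓ'hi⟩ := abs_le.1 hℓ'd
  obtain ⟨hhd1, hhd2⟩ := abs_le.1 hhd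
  have h1T200 : 1 / T ≤ 1 / 200 := one_div_le_one_div_of_le (by norm_num) hT
  have hh'35 : bandRadius k T' ≤ 3 / 5 := by linarith only [hhd1, hhub, h1T200]
  -- `ℓ' ≥ 31/a₀`, `1/T ≤ 1/ℓ'`
  have hainv : 28 ≤ 1 / a₀ := by rw [le_one_div (by norm_num) ha₀]; linarith only [ha₀1]
  have hℓ'a : 31 / a₀ ≤ ell T' := by
    have : 31 / a₀ = 32 / a₀ - 1 / a₀ := by ring
    rw [this]; linarith only [hℓa, hℓ'lo, hainv]
  have hℓT : ell T ≤ T - 1 := ell_le_sub_one hT100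
  have h1Tℓ' : 1 / T ≤ 1 / ell T' :=
    one_div_le_one_div_of_le hℓ'0 (by linarith only [hℓT, hℓ'hi])
  -- (1) the saddle `u'` of the point `x' + iT'`
  obtain ⟨u', hS', hu'⟩ := exists_arcSaddleFn_eq_zero (n := k) hx' hT'100 hℓ'20 hk100 hh' hh'T'
  obtain ⟨hRe', -, hr'lo, hr'hi⟩ := arcSaddle_sharp_polar hx' hT'100 hℓ'20 hk100 hh' hh'T' hH' hu' hS'
  -- `ε' ≤ 3.92/ℓ' ≤ 0.13 a₀`
  have hε' : (2 + 16 / 5 * bandRadius k T') / ell T' ≤ 3.92 / ell T' :=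
    div_le_div_of_nonneg_right (by linarith only [hh'35]) hℓ'0.le
  have hε'a : 3.92 / ell T' + 1 / ell T' ≤ 4 * a₀ / 25 := by
    rw [← add_div, div_le_iff₀ hℓ'0]
    have := (div_le_iff₀ ha₀).1 hℓ'a
    nlinarith only [this, ha₀]
  have hε'1 : 3.92 / ell T' ≤ 3.92 / 100 := div_le_div_of_nonneg_left (by norm_num) (by norm_num) hℓ'100
  have h2ℓ : 2 / ell T ≤ a₀ / 16 := by
    rw [div_le_iff₀ hℓ0]
    have := (div_le_iff₀ ha₀).1 hℓa
    nlinarith only [this, ha₀]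
  have h1ℓ' : 0 ≤ 1 / ell T' := by positivity
  -- the abscissa of the point and the window abscissa `σ' = ½ + x' + Re(u' − z)`
  have hx'lo : x - 2 / ell T ≤ x' := by
    have e : (((x' : ℂ) + (T' : ℂ) * I) - ((x : ℂ) + (T : ℂ) * I)).re = x' - x := by simp
    have h1 := (Complex.abs_re_le_norm (((x' : ℂ) + (T' : ℂ) * I) - ((x : ℂ) + (T : ℂ) * I))).trans hz
    rw [e] at h1
    have := (abs_le.1 h1).1
    linarith only [this]
  have hxlo : -a₀ ≤ x := (abs_le.1 hx).1
  have hσ_eq : (1 / 2 + u').re = 1 / 2 + x' + (u' - ((x' : ℂ) + (T' : ℂ) * I)).re := by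
    have e1 : (u' - ((x' : ℂ) + (T' : ℂ) * I)).re = u'.re - x' := by simp
    have e2 : (1 / 2 + u').re = 1 / 2 + u'.re := by simp
    rw [e1, e2]; ring
  have hσ' : 1 + 3 * a₀ / 4 ≤ (1 / 2 + u').re := by
    rw [hσ_eq]
    linarith only [hRe', hε', hε'a, h2ℓ, hx'lo, hxlo, hh, hhd2, h1Tℓ', ha₀]
  have hσ1' : 1 < (1 / 2 + u').re := by linarith only [hσ', ha₀]
  have hRe'pos : 0 < (u' - ((x' : ℂ) + (T' : ℂ) * I)).re := by
    linarith only [hRe', hε', hε'1, hh']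
  -- window parameters `ψ₁ = a₀/320`, `δ = a₀/2`
  have hψ₁ : 0 < a₀ / 320 := by positivity
  have hψ₁s : a₀ / 320 ≤ 11 / 320 := by linarith only [ha₀1]
  have hr1 : ‖u' - ((x' : ℂ) + (T' : ℂ) * I)‖ ≤ 1 := by linarith only [hr'hi, hh'35, hε', hε'1]
  have hr_pos : 0 < ‖u' - ((x' : ℂ) + (T' : ℂ) * I)‖ := by linarith only [hr'lo, hh', hε', hε'1]
  have hrinv : 1 / ‖u' - ((x' : ℂ) + (T' : ℂ) * I)‖ ≤ 4 := by
    rw [div_le_iff₀ hr_pos]; linarith only [hr'lo, hh', hε', hε'1]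
  have hψ₁r : ‖u' - ((x' : ℂ) + (T' : ℂ) * I)‖ * (a₀ / 320) ≤ 1 / 20 * bandRadius k T' := by
    have h1 : ‖u' - ((x' : ℂ) + (T' : ℂ) * I)‖ * (a₀ / 320) ≤ 1 * (1 / 320) :=
      mul_le_mul hr1 (by linarith only [ha₀1]) (by positivity) (by norm_num)
    linarith only [h1, hh']
  have hδ : 0 < a₀ / 2 := by positivity
  have hδ1 : a₀ / 2 ≤ 1 := by linarith only [ha₀1]
  have hwin : 1 + a₀ / 2 + ‖u' - ((x' : ℂ) + (T' : ℂ) * I)‖ * (a₀ / 320) ≤ (1 / 2 + u').re := by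
    have h1 : ‖u' - ((x' : ℂ) + (T' : ℂ) * I)‖ * (a₀ / 320) ≤ 1 * (a₀ / 320) :=
      mul_le_mul_of_nonneg_right hr1 hψ₁.le
    linarith only [h1, hσ', ha₀]
  have hgain : a₀ / 4 ≤ (1 / 2 + u').re - (1 + a₀ / 2) := by linarith only [hσ']
  -- `|h − r'| ≤ 5/ℓ'`
  have hρ : |bandRadius k T - ‖u' - ((x' : ℂ) + (T' : ℂ) * I)‖| ≤ 5 / ell T' := by
    have h1 : |bandRadius k T - ‖u' - ((x' : ℂ) + (T' : ℂ) * I)‖| ≤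
        |bandRadius k T - bandRadius k T'| + |bandRadius k T' - ‖u' - ((x' : ℂ) + (T' : ℂ) * I)‖| :=
      abs_sub_le _ _ _
    have h2 : |bandRadius k T' - ‖u' - ((x' : ℂ) + (T' : ℂ) * I)‖| ≤
        (2 + 16 / 5 * bandRadius k T') / ell T' :=
      abs_le.2 ⟨by linarith only [hr'hi], by linarith only [hr'lo]⟩
    have h3 : 1 / ell T' + 3.92 / ell T' ≤ 5 / ell T' := by
      rw [← add_div]; exact div_le_div_of_nonneg_right (by norm_num) hℓ'0.le
    linarith only [h1, h2, hhd, hε', h1Tℓ', h3]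
  have hd1 : |bandRadius k T - ‖u' - ((x' : ℂ) + (T' : ℂ) * I)‖| ≤ 1 := by
    have : 5 / ell T' ≤ 5 / 100 := div_le_div_of_nonneg_left (by norm_num) (by norm_num) hℓ'100
    linarith only [hρ, this]
  -- (2) the model comparison `‖Main(z,u') − M̃(z)‖ ≤ ‖M̃(z)‖/100`
  have hR20 : 2 / ell T ≤ 1 / 20 := by
    rw [div_le_iff₀ hℓ0]; linarith only [hℓ]
  have hδσ : 1 + a₀ / 2 + 2 * (2 / ell T) ≤ (1 / 2 + u₀).re := by linarith only [hσ₀, h2ℓ, ha₀]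
  have hcmp := norm_arcMainTerm_sub_arcShiftModel_le_of_large hx12 hT100 hℓ20 hk100 hh12 hhT hH20 hu₀
    hS₀ hx' hT'100 hℓ'20 hh' hh'T' hH' hu' hS' hR20 hz hδ hδσ hlarge
  -- (3) sizes at the point
  obtain ⟨-, hwre, hwnorm⟩ := descentDensity_saddle hx' hT'100 hℓ'20 hk100 hh' hh'T' hu' hS'
  have hZ := zeta_window_lower (a₀ := a₀ / 4) (u := u') (by positivity)
    (by linarith only [ha₀1, ha₀]) (by linarith only [hσ', ha₀])
  have hIpk_pos := arcModelIntegrand_saddle_norm_pos hx' hT'100 hh' hh'T' hu' hRe'pos hσ1'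
  have hMain := norm_arcMainTerm_eq_integrand k ((x' : ℂ) + (T' : ℂ) * I) u'
  have hs := main_factor_ge hk1 hwre hwnorm
  -- (4) `W ≤ (1/10)/√k`
  have hηeq : ‖u' - ((x' : ℂ) + (T' : ℂ) * I)‖ * (a₀ / 320) / (a₀ / 2) =
      ‖u' - ((x' : ℂ) + (T' : ℂ) * I)‖ * (a₀ / 160) / a₀ := by
    field_simp; ring
  obtain ⟨hη0, hη⟩ := eta_le_hundredth (a₀ := a₀) (norm_nonneg (u' - ((x' : ℂ) + (T' : ℂ) * I)))
    hr1 ha₀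
  rw [← hηeq] at hη0 hη
  have hRw : 11 * (k : ℝ) / 40 ≤ (deriv (arcSaddleFn k ((x' : ℂ) + (T' : ℂ) * I)) u' *
      (u' - ((x' : ℂ) + (T' : ℂ) * I)) ^ 2 / 2).re := by linarith only [hwre]
  have hW := window_bracket_le_tenth hk1 hRw hη0 hη hψ₁ hE1 hE2
  -- (5) the junk `πF' + |h − r'|V' ≤ (a₀/400)/√k`
  have hℓ'c : ell T' ≤ c * k / 2 + 1 := by linarith only [hℓ'hi, hℓhi]
  have hlog_r := log_height_le' (k := k) (y := ‖u' - ((x' : ℂ) + (T' : ℂ) * I)‖) hT'100 hℓ'c hc8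
    (norm_nonneg _) (by linarith only [hr1])
  have hlog_r1 := log_height_le' (k := k) (y := ‖u' - ((x' : ℂ) + (T' : ℂ) * I)‖ + 1) hT'100 hℓ'c
    hc8 (by positivity) (by linarith only [hr1])
  have hlog_r10 : 0 ≤ Real.log (T' + (‖u' - ((x' : ℂ) + (T' : ℂ) * I)‖ + 1)) :=
    Real.log_nonneg (by linarith only [hT'100, hr_pos])
  have hck : 7 * ((k : ℝ) - 1) ≤ c * ((k : ℝ) - 1) :=
    mul_le_mul_of_nonneg_right hc7 (by linarith only [hkR])
  have hℓ'k : 7 * (k : ℝ) / 4 - 5 ≤ ell T' / 2 - 1 := by linarith only [hℓ'lo, hℓlo, hck]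
  have hG := gain_exp_le' (a₀ := a₀ / 4) (δ' := a₀ / 2) (k := k) (by positivity)
    (by linarith only [ha₀1, ha₀]) hℓ'k (by linarith only [hℓ'20]) hgain
  have hF := near_flank_bracket_le (k := k) (h := bandRadius k T')
    (L := Real.log (T' + ‖u' - ((x' : ℂ) + (T' : ℂ) * I)‖)) hδ hψ₁.le
    (by linarith only [hψ₁s] : a₀ / 320 ≤ 1) hh'35 hlog_r hG
  have hVB := near_bridge_bracket_le (k := k) (h := bandRadius k T') hh'35 hr_pos hrinv hd1 hlog_r10
    hlog_r1 hG
  have hradd : T' + (‖u' - ((x' : ℂ) + (T' : ℂ) * I)‖ + 1) =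
      T' + ‖u' - ((x' : ℂ) + (T' : ℂ) * I)‖ + 1 := by ring
  rw [hradd] at hVB
  have hJ := near_junk_le (a₀ := a₀ / 4) (τ := a₀ / 4 / 100) hk1 hδ (by positivity) hF hVB hEC hED
  -- (6) the window lemma at the point with the centre's radius `h`, and the abstract combination
  have hN : 0 < (k.factorial : ℝ) / (2 * π) := by positivity
  have hsk : 0 < Real.sqrt k := Real.sqrt_pos.2 (by linarith only [hkR])
  have hS5 := norm_xiSqArcU_sub_arcMainTerm_le' hx' hT'100 hℓ'100 hk100 hh' hh'T' hH' hu' hS' hψ₁ hψ₁s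
    hψ₁r hδ hδ1 hwin hh0 hρ
  exact disc_bound_core' hN hIpk_pos hsk (by positivity : 0 < a₀ / 4) hS5 hMain hs hZ hW hJ hcmp

end Summit.RiemannHypothesis.RiemannHypothesis.Theorems.JensenPolynomials.LogBandArc

end
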